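import Mathlib
import Literature.MathematicalPhysics.QuantumFieldTheory.Balaban1983to89.B5Prop11SettingModel
import Literature.MathematicalPhysics.QuantumFieldTheory.Balaban1983to89.B5Blocks16
import Literature.MathematicalPhysics.QuantumFieldTheory.Balaban1983to89.B5RealFields
import Literature.MathematicalPhysics.QuantumFieldTheory.Balaban1983to89.B5G183RateOp

/-!
# B5 p. 39: «we have Proposition 1.1 for G₀», `G₀ = (Δ + aQ*Q)⁻¹` — PROVED for the typed torus operators,
# and `B5.Prop11Printed` INHABITED BY NAME for the `G₀` lattice family

statement-level skeleton of published theorems with citation tags; proofs where landed; nothing here is a claim about the Yang–Mills mass gap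

(v1.1, lit-balaban r02 gen 5, 2026-08-21: docstring-only — the cell's verbatim page-1 framing line above added on the
referee's request N-g16-1 (ref-3 gen 16); no declaration changed, v1 = p251794.)

Source: T. Bałaban, *Propagators and renormalization transformations for lattice gauge theories. I*,
Commun. Math. Phys. 95 (1984) 17–40 (`Balaban1984PropagatorsI`, "B5"), p. 33 (Proposition 1.1,
(1.89)–(1.90)) and p. 39 ((1.132)–(1.134)), read from `paper:balaban1984-cmp95-propagators-rt-i`
(journal page = PDF page + 16).

## What the paper prints (p. 39, verbatim)

«Denoting the operator Δ + aQ*Q by G₀⁻¹, we have G = G₀ + G₀∂P∂*G, (1.132) … This operator is given by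
the formula G₀J = Δ⁻¹J − aΔ⁻¹Q*φ⁻¹QΔ⁻¹J (1.134) for J orthogonal to constant functions, and G₀J = a⁻¹J for
J constant, hence by the first two terms in the representation (1.81). Thus its momentum representation
is given by (1.87) and we have Proposition 1.1 for G₀.»  Proposition 1.1 (p. 33): «The operator G is a
symmetric operator on L²(T_η) and ‖GJ‖, ‖∇GJ‖, ‖G∇*J‖, ‖∇G∇*J‖, ‖∇∇GJ‖, ‖G∇*∇*J‖ ≤ γ₀⁻¹‖J‖, (1.89)
with a positive constant γ₀ independent of k, T_η, and depending on d only (if we put a = 1). This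
implies the bound from below: Δ_a = G⁻¹ ≥ γ₀(Δ + I). (1.90)»

«Proposition 1.1 for G₀» is the named input `h11G0 : B5.Prop11Printed famG0` of the composed
Proposition-1.2 chain `B5Prop12Chain.prop12_of_B4_walk` (cell INTERFACES §1; ROWS-B5 rows B5.Eq1.134,
B5.Prop1.2).  Pass p15 (`B5Prop11SettingModel`) inhabited `B5.Prop11Printed` by name for `G = Δ_a⁻¹`;
this module does the same for `G₀ = (Δ + aQ*Q)⁻¹`, on the SAME typed objects.

## What this module proves, and how (the proof is NOT the paper's multiplier computation)

The objects are those of `B5Prop11Lattice` / `B5DeltaA169`: the fine torus `T_η = Tor (fine n M)`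
(`η = 1/n`), vector fields `J : T_η × Fin d → ℂ`, `∇_ν = fdiff (fine n M) n ν` ((1.31)),
`Δ = B5Prop11Lower.Lap n M = Σ_ν ∇_ν^*∇_ν`, `Q = B5Block118.QvOp n M` ((1.18)), `Q* = η^{-d}Qᴴ =
B5DeltaA169.QvAdj n M`, `Δ_a = B5DeltaA169.DeltaA n M a = Δ − ∂P∂* + aQ*Q` ((1.69)), and
`G₀⁻¹ := G0inv n M a := Δ + aQ*Q`, `G₀ := G0 n M a := (G0inv n M a)⁻¹` ((1.132)).

The paper obtains Proposition 1.1 for `G₀` from the momentum representation (1.87) ("the first two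
terms of (1.81)").  We take a shorter road through results ALREADY IN THE TREE, by operator-norm algebra:
* §1 `G₀⁻¹ = Δ_a + ∂P∂*` (`G0inv_eq`, literally (1.69)) and `∂P∂* ≥ 0` (`P` an orthogonal projection,
  `B5Value126.PcT_mul_PcT` / `PcT_conjTranspose`), so the tree's (1.90) for `Δ_a`
  (`B5Prop11Lattice.ineq190 : γ₀(Δ+I) ≤ Δ_a`) gives **(1.90) for `G₀`**: `γ₀(Δ + I) ≤ Δ_a ≤ Δ + aQ*Q`
  (`smul_LapOne_le_G0inv`); hence `G₀⁻¹` is positive definite and `G₀` is symmetric (`G0_isHermitian`).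
* §2 evaluating that Löwner inequality on `x = G₀y` — `γ₀(‖x‖² + Σ_ν‖∇_ν x‖²) ≤ Re⟨x, y⟩ ≤ ‖x‖‖y‖`
  (`form_key`) — gives `‖G₀‖, ‖∇_νG₀‖ ≤ γ₀⁻¹`, by adjunction `‖G₀∇_ν^*‖ ≤ γ₀⁻¹`, and evaluating it on
  `x = G₀∇_ν^*y` gives `‖∇_μG₀∇_ν^*‖ ≤ γ₀⁻¹` (`l2_fdiff_G0_fdiffH_le`).
* §3 the second-order norms: all `∇_μ`, `∇_ν^*` commute on the torus (simultaneously diagonalised by the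
  DFT, `B5Prop11Plancherel.fdiff_eq`), whence `Σ_{μν}‖∇_μ∇_ν x‖² = ‖Δx‖²` (`sum_nsq_fdiff_fdiff`), and
  `Δx = y − aQ*Qx` for `x = G₀y` (`Lap_mulVec_G0`), so `‖∇_μ∇_νG₀y‖ ≤ (1 + a‖Q*Q‖γ₀⁻¹)‖y‖`;
* §4 `‖Q*Q‖ ≤ 1` uniformly in `η`, `T_η` (`opNorm_QQ_le`): the entries of `Q_k` are the nonnegative reals
  `qent` with row sums `1` (`qent_rowsum`) and column sums `η^d` (`qent_colsum`, every fine bond lies on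
  exactly `n` averaging segments by the block decomposition `B5Blocks16.bpt_bijective`), and the Schur test
  (`B5G183RateOp.opNorm_le_of_schur_isHermitian`);
* §5–§6 one constant `C₀(d,a) = 1 + (1+a)γ₀⁻¹` for the six componentwise operator norms
  (`ineq189_G0_opNorm`), the printed tensor form of (1.89) with `γ₀(G₀)⁻¹ = (d+1)·C₀(d,a)`
  (`ineq189_G0`, `ineq189_gradG0`, `ineq189_G0divT`, `ineq189_gradG0divT`, `ineq189_grad2G0`,
  `ineq189_G0divT2`, aggregation lemmas of `B5Prop11Lattice`), and (1.90) for `G₀` with `γ₀(G₀) ≤ γ₀`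
  (`ineq190_G0`, `ineq190_G0_form`);
* §7 Proposition 1.1 for `G₀` in the printed quantifier order (`prop11_G0_lattice`), the `B5.Setting`
  model `latticeSettingG0` (= `B5Prop11SettingModel.latticeSetting` with `l2op`, `formΔa` re-pointed at
  `G₀`, `G₀⁻¹`), and **`B5.Prop11Printed` by name** (`prop11Printed_latticeSettingG0`,
  `prop11Printed_scalesG0`, `prop11Printed_latticeSettingG0_one`).

DICTIONARY / DIVERGENCES (as in `B5Prop11Lattice`, cell DIVERGENCE.md D-pv15g3.3): the norms are the
unweighted `ℓ²` norms on `T_η` (equivalent to the `η^d`-weighted `L²(T_η)` norms of (1.21) for operators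
between fields on the same lattice); `∇`, `∇∇`, `∇*`, `∇*∇*` in the tensor reading (b) of
`B5Prop11Lattice`; the constants `C₀(d,a)`, `γ₀(G₀)(d,a)` are OURS (the paper prints none) and are not
the paper's; the proof is by the Löwner-order route above, not by (1.87).  Nothing here is progress on a
summit; value = kernel certificate, by name, of the printed sentence «we have Proposition 1.1 for G₀» for
the typed lattice operators, discharging the input `h11G0` of the Proposition-1.2 chain for the concrete
torus family.
-/

namespace Literature.MathematicalPhysics.QuantumFieldTheory.Balaban1983to89.B5Prop11G0Torus

open scoped BigOperators Matrix ComplexConjugate ComplexOrder Matrix.Norms.L2Operator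
open Finset Complex Matrix
open Literature.MathematicalPhysics.QuantumFieldTheory.Balaban1983to89
open Literature.MathematicalPhysics.QuantumFieldTheory.Balaban1983to89.B4Strip
open Literature.MathematicalPhysics.QuantumFieldTheory.Balaban1983to89.B5Prop11Plancherel
open Literature.MathematicalPhysics.QuantumFieldTheory.Balaban1983to89.B5Prop11Lower
open Literature.MathematicalPhysics.QuantumFieldTheory.Balaban1983to89.B5DeltaA169
open Literature.MathematicalPhysics.QuantumFieldTheory.Balaban1983to89.B5Prop11Lattice
open Literature.MathematicalPhysics.QuantumFieldTheory.Balaban1983to89.B5Action121 (GradOp)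
open Literature.MathematicalPhysics.QuantumFieldTheory.Balaban1983to89.B5Block118 (QvOp bpt tstep)
open Literature.MathematicalPhysics.QuantumFieldTheory.Balaban1983to89.B5Value126 (PcT PcT_mul_PcT PcT_conjTranspose)

noncomputable section

/-! ## §1 `G₀⁻¹ = Δ + aQ*Q = Δ_a + ∂P∂*` and its Löwner bounds -/

section Operator

variable {d : ℕ} (n : ℕ) [NeZero n] (hn : 1 ≤ n) (M : Fin d → ℕ) [hM : ∀ μ, NeZero (M μ)]
  (a : ℝ) (ha : 0 < a)

/-- `G₀⁻¹ := Δ + aQ*Q` on vector fields over `T_η` ((1.132): «G₀ = (Δ + aQ*Q)⁻¹»), with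
`Δ = Σ_ν ∇_ν^*∇_ν = B5Prop11Lower.Lap` and `Q* = η^{-d}Qᴴ = B5DeltaA169.QvAdj`.
[cite: Balaban1984PropagatorsI, (1.132) p.39] -/
def G0inv : Matrix (Tor (fine n M) × Fin d) (Tor (fine n M) × Fin d) ℂ :=
  Lap n M + (a : ℂ) • (QvAdj n M * QvOp n M)

/-- `G₀ := (Δ + aQ*Q)⁻¹`. [cite: Balaban1984PropagatorsI, (1.132) p.39] -/
def G0 : Matrix (Tor (fine n M) × Fin d) (Tor (fine n M) × Fin d) ℂ := (G0inv n M a)⁻¹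

/-- `Δ + aQ*Q = Δ_a + ∂P∂*` ((1.69): `Δ_a = Δ − ∂P∂* + aQ*Q`; this is the identity behind (1.132)).
[cite: Balaban1984PropagatorsI, (1.69) p.30, (1.132) p.39] -/
theorem G0inv_eq : G0inv n M a
    = DeltaA n M a + GradOp (fine n M) (n : ℂ) * PcT n M (n : ℂ) * (GradOp (fine n M) (n : ℂ))ᴴ := by
  rw [G0inv, DeltaA]
  abel

/-- `∂P∂*` is positive semidefinite (`P` is an orthogonal projection: `Pᴴ = P = P²`). [cite: Balaban1984PropagatorsI, (1.26) p.22, (1.69) p.30 (kernel lemma; proof ours)] -/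
private theorem dPd_posSemidef :
    (GradOp (fine n M) (n : ℂ) * PcT n M (n : ℂ) * (GradOp (fine n M) (n : ℂ))ᴴ).PosSemidef := by
  have hc : (n : ℂ) ≠ 0 := Nat.cast_ne_zero.mpr (NeZero.ne n)
  have hP : (PcT n M (n : ℂ)).PosSemidef := by
    have h : PcT n M (n : ℂ) = (PcT n M (n : ℂ))ᴴ * PcT n M (n : ℂ) := by
      rw [PcT_conjTranspose, PcT_mul_PcT n M (n : ℂ) hc]
    rw [h]
    exact Matrix.posSemidef_conjTranspose_mul_self _
  have h := hP.conjTranspose_mul_mul_same (GradOp (fine n M) (n : ℂ))ᴴ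
  rwa [Matrix.conjTranspose_conjTranspose] at h

open scoped MatrixOrder in
/-- `Δ_a ≤ Δ + aQ*Q` in the Löwner order. [cite: Balaban1984PropagatorsI, (1.69) p.30, (1.132) p.39 (kernel lemma; proof ours)] -/
theorem DeltaA_le_G0inv : DeltaA n M a ≤ G0inv n M a := by
  rw [Matrix.le_iff, G0inv_eq, add_sub_cancel_left]
  exact dPd_posSemidef n M

include hn ha

open scoped MatrixOrder in
/-- **(1.90) for `G₀`**: `γ₀(Δ + I) ≤ Δ + aQ*Q = G₀⁻¹`, `γ₀ = gammaZero d a` the constant of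
Proposition 1.1 for `G`. [cite: Balaban1984PropagatorsI, Prop. 1.1 (1.90) p.33, p.39 «we have
Proposition 1.1 for G₀» (kernel version; constant and proof ours)] -/
theorem smul_LapOne_le_G0inv : ((gammaZero d a : ℝ) : ℂ) • (Lap n M + 1) ≤ G0inv n M a :=
  (ineq190 n hn M a ha).trans (DeltaA_le_G0inv n M a)

/-- `Δ + aQ*Q` is positive definite. [cite: Balaban1984PropagatorsI, (1.132) p.39 (kernel lemma; proof ours)] -/
theorem G0inv_posDef : (G0inv n M a).PosDef := by
  rw [G0inv_eq]
  exact (DeltaA_posDef n hn M a ha).add_posSemidef (dPd_posSemidef n M)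

/-- `Δ + aQ*Q` is Hermitian. [cite: Balaban1984PropagatorsI, (1.132) p.39 (kernel lemma; proof ours)] -/
theorem G0inv_isHermitian : (G0inv n M a).IsHermitian := (G0inv_posDef n hn M a ha).isHermitian

/-- «The operator G₀ is a symmetric operator»: `G₀` is Hermitian. [cite: Balaban1984PropagatorsI,
Prop. 1.1 p.33, p.39 (proof ours)] -/
theorem G0_isHermitian : (G0 n M a).IsHermitian := (G0inv_isHermitian n hn M a ha).inv

/-- `G₀` is positive definite. [cite: Balaban1984PropagatorsI, (1.132) p.39 (kernel lemma; proof ours)] -/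
theorem G0_posDef : (G0 n M a).PosDef := (G0inv_posDef n hn M a ha).inv

/-- `(Δ + aQ*Q) G₀ = 1`. [cite: Balaban1984PropagatorsI, (1.132) p.39] -/
theorem G0inv_mul_G0 : G0inv n M a * G0 n M a = 1 :=
  Matrix.mul_nonsing_inv _ ((Matrix.isUnit_iff_isUnit_det _).mp (G0inv_posDef n hn M a ha).isUnit)

/-- `G₀ (Δ + aQ*Q) = 1`. [cite: Balaban1984PropagatorsI, (1.132) p.39] -/
theorem G0_mul_G0inv : G0 n M a * G0inv n M a = 1 :=
  Matrix.nonsing_inv_mul _ ((Matrix.isUnit_iff_isUnit_det _).mp (G0inv_posDef n hn M a ha).isUnit)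

end Operator

/-! ## §2 The quadratic form of `G₀⁻¹` and the four first/mixed-order norms of (1.89) for `G₀` -/

section FirstOrder

variable {d : ℕ} (n : ℕ) [NeZero n] (hn : 1 ≤ n) (M : Fin d → ℕ) [hM : ∀ μ, NeZero (M μ)]
  (a : ℝ) (ha : 0 < a)

/-- operator-norm bound from an `ℓ²` bound on every vector. [folklore] -/
private theorem opNorm_le_of_l2_bound {m : Type*} [Fintype m] [DecidableEq m] (X : Matrix m m ℂ) {C : ℝ}
    (hC : 0 ≤ C) (h : ∀ w : m → ℂ, l2 (X *ᵥ w) ≤ C * l2 w) : ‖X‖ ≤ C := by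
  refine MatrixNorms.opNorm_le_of_bound X hC fun ψ => ?_
  have e1 : ‖Matrix.toEuclideanCLM (n := m) (𝕜 := ℂ) X ψ‖ = l2 (X *ᵥ (fun i => ψ i)) := by
    rw [B5Prop11Bound.norm_eq_l2n]
    unfold B5Prop11Bound.l2n l2 nsq
    congr 1
  have e2 : ‖ψ‖ = l2 (fun i => ψ i) := by
    rw [B5Prop11Bound.norm_eq_l2n]
    rfl
  rw [e1, e2]
  exact h _

/-- `‖u‖ ≤ B` from `‖u‖² ≤ B²`, `B ≥ 0`. [folklore] -/
private theorem l2_le_of_nsq_le {m : Type*} [Fintype m] {u : m → ℂ} {B : ℝ} (hB : 0 ≤ B)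
    (h : nsq u ≤ B ^ 2) : l2 u ≤ B := by
  unfold l2
  rw [← Real.sqrt_sq hB]
  exact Real.sqrt_le_sqrt h

/-- from `γ s² ≤ s t`, `s, t ≥ 0`, `γ > 0`: `s ≤ γ⁻¹ t`. [folklore] -/
private theorem le_inv_mul_of_sq_le {γ s t : ℝ} (hγ : 0 < γ) (hs : 0 ≤ s) (ht : 0 ≤ t)
    (h : γ * s ^ 2 ≤ s * t) : s ≤ γ⁻¹ * t := by
  rcases hs.eq_or_lt with hs0 | hs0
  · rw [← hs0]
    exact mul_nonneg (inv_nonneg.mpr hγ.le) ht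
  · rw [le_inv_mul_iff₀ hγ]
    nlinarith

/-- one term of a sum of nonnegative reals is at most the sum. [folklore] -/
private theorem nsq_le_sum_opt {m : Type*} [Fintype m] {d : ℕ} (F : Option (Fin d) → m → ℂ)
    (α : Option (Fin d)) : nsq (F α) ≤ ∑ β, nsq (F β) :=
  Finset.single_le_sum (f := fun β => nsq (F β)) (fun _ _ => nsq_nonneg _) (Finset.mem_univ α)

include hn ha

/-- THE FORM INEQUALITY: `γ₀ Σ_α ‖V_α x‖² ≤ Re⟨x, G₀⁻¹x⟩` (`V_none = 1`, `V_ν = ∇_ν`), i.e. (1.90)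
for `G₀` evaluated on a vector. [cite: Balaban1984PropagatorsI, Prop. 1.1 (1.90) p.33, p.39
(kernel version; constant and proof ours)] -/
theorem form_key (x : Tor (fine n M) × Fin d → ℂ) :
    gammaZero d a * ∑ α, nsq (Vb n M α *ᵥ x) ≤ (star x ⬝ᵥ (G0inv n M a *ᵥ x)).re := by
  have hpsd : (G0inv n M a - ((gammaZero d a : ℝ) : ℂ) • (Lap n M + 1)).PosSemidef :=
    Matrix.le_iff.mp (smul_LapOne_le_G0inv n hn M a ha)
  have h := hpsd.dotProduct_mulVec_nonneg x
  rw [Matrix.sub_mulVec, dotProduct_sub, Matrix.smul_mulVec, dotProduct_smul, smul_eq_mul,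
    form_LapOne, ← Complex.ofReal_mul, Complex.le_def] at h
  have h1 := h.1
  rw [Complex.sub_re, Complex.ofReal_re, Complex.zero_re] at h1
  linarith

/-- `G₀⁻¹(G₀u) = u`. [cite: Balaban1984PropagatorsI, (1.132) p.39] -/
theorem G0inv_mulVec_G0 (u : Tor (fine n M) × Fin d → ℂ) :
    G0inv n M a *ᵥ (G0 n M a *ᵥ u) = u := by
  rw [Matrix.mulVec_mulVec, G0inv_mul_G0 n hn M a ha, Matrix.one_mulVec]

/-- for `x = G₀y`: `γ₀ Σ_α ‖V_α G₀y‖² ≤ Re⟨G₀y, y⟩ ≤ ‖G₀y‖‖y‖`. [cite: Balaban1984PropagatorsI, Prop. 1.1 (1.90) p.33, p.39 (kernel lemma; proof ours)] -/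
theorem form_key_G0 (y : Tor (fine n M) × Fin d → ℂ) :
    gammaZero d a * ∑ α, nsq (Vb n M α *ᵥ (G0 n M a *ᵥ y)) ≤ l2 (G0 n M a *ᵥ y) * l2 y := by
  have h := form_key n hn M a ha (G0 n M a *ᵥ y)
  rw [G0inv_mulVec_G0 n hn M a ha] at h
  exact h.trans ((Complex.re_le_norm _).trans (norm_star_dotProduct_le _ _))

/-- (1.89) for `G₀`, first bound: `‖G₀y‖ ≤ γ₀⁻¹‖y‖`. [cite: Balaban1984PropagatorsI, Prop. 1.1
(1.89) p.33, p.39 (kernel version; constant and proof ours)] -/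
theorem l2_G0_le (y : Tor (fine n M) × Fin d → ℂ) :
    l2 (G0 n M a *ᵥ y) ≤ (gammaZero d a)⁻¹ * l2 y := by
  have h := form_key_G0 n hn M a ha y
  have h0 : nsq (G0 n M a *ᵥ y) ≤ ∑ β, nsq (Vb n M β *ᵥ (G0 n M a *ᵥ y)) := by
    have h' := nsq_le_sum_opt (fun β => Vb n M β *ᵥ (G0 n M a *ᵥ y)) none
    simpa only [Vb, Matrix.one_mulVec] using h'
  refine le_inv_mul_of_sq_le (gammaZero_pos d a) (l2_nonneg _) (l2_nonneg _) ?_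
  rw [l2_sq]
  exact (mul_le_mul_of_nonneg_left h0 (gammaZero_pos d a).le).trans h

/-- (1.89) for `G₀`, second bound componentwise: `‖∇_ν G₀y‖ ≤ γ₀⁻¹‖y‖`.
[cite: Balaban1984PropagatorsI, Prop. 1.1 (1.89) p.33, p.39 (kernel version; constant and proof
ours)] -/
theorem l2_fdiff_G0_le (ν : Fin d) (y : Tor (fine n M) × Fin d → ℂ) :
    l2 (fdiff (fine n M) (n : ℂ) ν *ᵥ (G0 n M a *ᵥ y)) ≤ (gammaZero d a)⁻¹ * l2 y := by
  have hγ := gammaZero_pos d a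
  have h := form_key_G0 n hn M a ha y
  have h1 : nsq (fdiff (fine n M) (n : ℂ) ν *ᵥ (G0 n M a *ᵥ y))
      ≤ ∑ β, nsq (Vb n M β *ᵥ (G0 n M a *ᵥ y)) :=
    nsq_le_sum_opt (fun β => Vb n M β *ᵥ (G0 n M a *ᵥ y)) (some ν)
  have h2 := l2_G0_le n hn M a ha y
  refine l2_le_of_nsq_le (mul_nonneg (inv_nonneg.mpr hγ.le) (l2_nonneg _)) ?_
  have h3 : gammaZero d a * nsq (fdiff (fine n M) (n : ℂ) ν *ᵥ (G0 n M a *ᵥ y))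
      ≤ (gammaZero d a)⁻¹ * l2 y * l2 y :=
    ((mul_le_mul_of_nonneg_left h1 hγ.le).trans h).trans
      (mul_le_mul_of_nonneg_right h2 (l2_nonneg _))
  calc nsq (fdiff (fine n M) (n : ℂ) ν *ᵥ (G0 n M a *ᵥ y))
        ≤ (gammaZero d a)⁻¹ * l2 y * l2 y / gammaZero d a := by
          rw [le_div_iff₀ hγ, mul_comm]
          exact h3
    _ = ((gammaZero d a)⁻¹ * l2 y) ^ 2 := by rw [div_eq_mul_inv]; ring

/-- (1.89) for `G₀`, fourth bound componentwise: `‖∇_μ G₀ ∇_ν^* y‖ ≤ γ₀⁻¹‖y‖`.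
[cite: Balaban1984PropagatorsI, Prop. 1.1 (1.89) p.33, p.39 (kernel version; constant and proof
ours)] -/
theorem l2_fdiff_G0_fdiffH_le (μ ν : Fin d) (y : Tor (fine n M) × Fin d → ℂ) :
    l2 (fdiff (fine n M) (n : ℂ) μ *ᵥ (G0 n M a *ᵥ ((fdiff (fine n M) (n : ℂ) ν)ᴴ *ᵥ y)))
      ≤ (gammaZero d a)⁻¹ * l2 y := by
  have hγ := gammaZero_pos d a
  obtain ⟨x, hx⟩ : ∃ x, x = G0 n M a *ᵥ ((fdiff (fine n M) (n : ℂ) ν)ᴴ *ᵥ y) := ⟨_, rfl⟩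
  rw [← hx]
  -- the form inequality at `x = G₀∇_ν^*y`: `γ₀ Σ_α ‖V_α x‖² ≤ Re⟨x, ∇_ν^*y⟩ = Re⟨∇_ν x, y⟩ ≤ ‖∇_ν x‖‖y‖`
  have hform : gammaZero d a * ∑ α, nsq (Vb n M α *ᵥ x)
      ≤ l2 (fdiff (fine n M) (n : ℂ) ν *ᵥ x) * l2 y := by
    have h := form_key n hn M a ha x
    have hGx : G0inv n M a *ᵥ x = (fdiff (fine n M) (n : ℂ) ν)ᴴ *ᵥ y := by
      rw [hx, G0inv_mulVec_G0 n hn M a ha]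
    rw [hGx, Matrix.dotProduct_mulVec, Matrix.vecMul_conjTranspose, star_star] at h
    exact h.trans ((Complex.re_le_norm _).trans (norm_star_dotProduct_le _ _))
  -- `s := ‖∇_ν x‖ ≤ γ₀⁻¹‖y‖`
  have hs : l2 (fdiff (fine n M) (n : ℂ) ν *ᵥ x) ≤ (gammaZero d a)⁻¹ * l2 y := by
    refine le_inv_mul_of_sq_le hγ (l2_nonneg _) (l2_nonneg _) ?_
    rw [l2_sq]
    exact (mul_le_mul_of_nonneg_left (nsq_le_sum_opt (fun β => Vb n M β *ᵥ x) (some ν))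
      hγ.le).trans hform
  -- `‖∇_μ x‖² ≤ Σ_α ≤ γ₀⁻¹ s ‖y‖ ≤ (γ₀⁻¹‖y‖)²`
  refine l2_le_of_nsq_le (mul_nonneg (inv_nonneg.mpr hγ.le) (l2_nonneg _)) ?_
  have h3 : gammaZero d a * nsq (fdiff (fine n M) (n : ℂ) μ *ᵥ x)
      ≤ (gammaZero d a)⁻¹ * l2 y * l2 y :=
    ((mul_le_mul_of_nonneg_left (nsq_le_sum_opt (fun β => Vb n M β *ᵥ x) (some μ)) hγ.le).trans
      hform).trans (mul_le_mul_of_nonneg_right hs (l2_nonneg _))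
  calc nsq (fdiff (fine n M) (n : ℂ) μ *ᵥ x)
        ≤ (gammaZero d a)⁻¹ * l2 y * l2 y / gammaZero d a := by
          rw [le_div_iff₀ hγ, mul_comm]
          exact h3
    _ = ((gammaZero d a)⁻¹ * l2 y) ^ 2 := by rw [div_eq_mul_inv]; ring

/-- `‖G₀‖ ≤ γ₀⁻¹`. [cite: Balaban1984PropagatorsI, Prop. 1.1 (1.89) p.33, p.39 (kernel version;
constant and proof ours)] -/
theorem opNorm_G0_le : ‖G0 n M a‖ ≤ (gammaZero d a)⁻¹ :=
  opNorm_le_of_l2_bound _ (inv_nonneg.mpr (gammaZero_pos d a).le) (l2_G0_le n hn M a ha)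

/-- `‖∇_ν G₀‖ ≤ γ₀⁻¹`. [cite: Balaban1984PropagatorsI, Prop. 1.1 (1.89) p.33, p.39 (kernel
version; constant and proof ours)] -/
theorem opNorm_fdiff_G0_le (ν : Fin d) :
    ‖fdiff (fine n M) (n : ℂ) ν * G0 n M a‖ ≤ (gammaZero d a)⁻¹ :=
  opNorm_le_of_l2_bound _ (inv_nonneg.mpr (gammaZero_pos d a).le) fun w => by
    rw [← Matrix.mulVec_mulVec]
    exact l2_fdiff_G0_le n hn M a ha ν w

/-- `‖G₀ ∇_ν^*‖ ≤ γ₀⁻¹` (the adjoint of `∇_ν G₀`, `G₀` symmetric). [cite: Balaban1984PropagatorsI,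
Prop. 1.1 (1.89) p.33, p.39 (kernel version; constant and proof ours)] -/
theorem opNorm_G0_star_fdiff_le (ν : Fin d) :
    ‖G0 n M a * star (fdiff (fine n M) (n : ℂ) ν)‖ ≤ (gammaZero d a)⁻¹ := by
  have h : G0 n M a * star (fdiff (fine n M) (n : ℂ) ν) = (fdiff (fine n M) (n : ℂ) ν * G0 n M a)ᴴ := by
    rw [Matrix.conjTranspose_mul, (G0_isHermitian n hn M a ha).eq, Matrix.star_eq_conjTranspose]
  rw [h, Matrix.l2_opNorm_conjTranspose]
  exact opNorm_fdiff_G0_le n hn M a ha ν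

/-- `‖∇_μ G₀ ∇_ν^*‖ ≤ γ₀⁻¹`. [cite: Balaban1984PropagatorsI, Prop. 1.1 (1.89) p.33, p.39 (kernel
version; constant and proof ours)] -/
theorem opNorm_fdiff_G0_star_fdiff_le (μ ν : Fin d) :
    ‖fdiff (fine n M) (n : ℂ) μ * G0 n M a * star (fdiff (fine n M) (n : ℂ) ν)‖
      ≤ (gammaZero d a)⁻¹ :=
  opNorm_le_of_l2_bound _ (inv_nonneg.mpr (gammaZero_pos d a).le) fun w => by
    rw [← Matrix.mulVec_mulVec, ← Matrix.mulVec_mulVec, Matrix.star_eq_conjTranspose]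
    exact l2_fdiff_G0_fdiffH_le n hn M a ha μ ν w

end FirstOrder

/-! ## §3 The lattice differences commute; `Σ_{μν} ‖∇_μ∇_ν x‖² = ‖Δx‖²` -/

section Commute

variable {d : ℕ} (N : Fin d → ℕ) [hN : ∀ μ, NeZero (N μ)] (c : ℂ)

/-- product of two Fourier multipliers: `(U^*D₁U)(U^*D₂U) = U^*(D₁D₂)U`. [folklore] -/
private theorem dftV_sandwich_mul (D₁ D₂ : Tor N × Fin d → ℂ) :
    (star (dftV N) * Matrix.diagonal D₁ * dftV N) * (star (dftV N) * Matrix.diagonal D₂ * dftV N)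
      = star (dftV N) * Matrix.diagonal (fun i => D₁ i * D₂ i) * dftV N := by
  calc (star (dftV N) * Matrix.diagonal D₁ * dftV N) * (star (dftV N) * Matrix.diagonal D₂ * dftV N)
      = star (dftV N) * Matrix.diagonal D₁ * (dftV N * star (dftV N)) * Matrix.diagonal D₂
          * dftV N := by simp only [Matrix.mul_assoc]
    _ = star (dftV N) * Matrix.diagonal (fun i => D₁ i * D₂ i) * dftV N := by
          rw [dftV_mul_star, Matrix.mul_one, Matrix.mul_assoc (star (dftV N)),
            Matrix.diagonal_mul_diagonal]

/-- the forward differences commute: `∇_μ∇_ν = ∇_ν∇_μ` (translations of the torus commute).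
[cite: Balaban1984PropagatorsI, (1.31) p.23 (Fourier symbols; kernel lemma, proof ours)] -/
theorem fdiff_comm (μ ν : Fin d) : fdiff N c μ * fdiff N c ν = fdiff N c ν * fdiff N c μ := by
  rw [fdiff_eq N c μ, fdiff_eq N c ν, dftV_sandwich_mul, dftV_sandwich_mul,
    show (fun i => fsym N c μ i * fsym N c ν i) = fun i => fsym N c ν i * fsym N c μ i from
      funext fun i => mul_comm (fsym N c μ i) (fsym N c ν i)]

/-- `∇_μ^*∇_ν = ∇_ν∇_μ^*`. [cite: Balaban1984PropagatorsI, (1.31) p.23 (Fourier symbols; kernel lemma, proof ours)] -/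
theorem fdiffH_fdiff_comm (μ ν : Fin d) :
    (fdiff N c μ)ᴴ * fdiff N c ν = fdiff N c ν * (fdiff N c μ)ᴴ := by
  rw [← Matrix.star_eq_conjTranspose, star_fdiff_eq, fdiff_eq N c ν, dftV_sandwich_mul,
    dftV_sandwich_mul,
    show (fun i => (star (fsym N c μ)) i * fsym N c ν i) = fun i => fsym N c ν i * (star (fsym N c μ)) i
      from funext fun i => mul_comm ((star (fsym N c μ)) i) (fsym N c ν i)]

end Commute

section SecondOrder

variable {d : ℕ} (n : ℕ) [NeZero n] (hn : 1 ≤ n) (M : Fin d → ℕ) [hM : ∀ μ, NeZero (M μ)]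
  (a : ℝ) (ha : 0 < a)

/-- `Δ∇_ν = ∇_νΔ`. [cite: Balaban1984PropagatorsI, (1.31) p.23 (Fourier symbols; kernel lemma, proof ours)] -/
theorem Lap_mul_fdiff (ν : Fin d) :
    Lap n M * fdiff (fine n M) (n : ℂ) ν = fdiff (fine n M) (n : ℂ) ν * Lap n M := by
  rw [Lap, Finset.sum_mul, Finset.mul_sum]
  refine Finset.sum_congr rfl fun μ _ => ?_
  rw [Matrix.mul_assoc, fdiff_comm, ← Matrix.mul_assoc, fdiffH_fdiff_comm, Matrix.mul_assoc]

/-- `⟨z, Δz⟩ = Σ_μ ‖∇_μ z‖²` (as a complex number). [cite: Balaban1984PropagatorsI, (1.21) p.21 (kernel lemma; proof ours)] -/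
theorem form_Lap (z : Tor (fine n M) × Fin d → ℂ) :
    star z ⬝ᵥ (Lap n M *ᵥ z) = ((∑ μ, nsq (fdiff (fine n M) (n : ℂ) μ *ᵥ z) : ℝ) : ℂ) := by
  rw [Lap, Matrix.sum_mulVec, dotProduct_sum, Complex.ofReal_sum]
  exact Finset.sum_congr rfl fun μ _ => form_gram _ _

/-- `Δw = Σ_ν ∇_ν^*∇_ν w`. [folklore] -/
private theorem Lap_mulVec_sum (w : Tor (fine n M) × Fin d → ℂ) :
    Lap n M *ᵥ w = ∑ ν, ((fdiff (fine n M) (n : ℂ) ν)ᴴ * fdiff (fine n M) (n : ℂ) ν) *ᵥ w := by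
  rw [Lap, Matrix.sum_mulVec]

/-- `⟨v, Δw⟩ = ⟨Δv, w⟩` (`Δ` Hermitian). [folklore] -/
private theorem star_dotProduct_Lap_mulVec (v w : Tor (fine n M) × Fin d → ℂ) :
    star v ⬝ᵥ (Lap n M *ᵥ w) = star (Lap n M *ᵥ v) ⬝ᵥ w := by
  have h : star v ᵥ* Lap n M = star (Lap n M *ᵥ v) := by
    conv_lhs => rw [← (B5RealFields.Lap_isHermitian n M).eq]
    rw [Matrix.vecMul_conjTranspose, star_star]
  rw [Matrix.dotProduct_mulVec, h]

/-- `⟨v, ∇_ν^*w⟩ = ⟨∇_ν v, w⟩`. [folklore] -/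
private theorem star_dotProduct_fdiffH_mulVec (ν : Fin d) (v w : Tor (fine n M) × Fin d → ℂ) :
    star v ⬝ᵥ ((fdiff (fine n M) (n : ℂ) ν)ᴴ *ᵥ w) = star (fdiff (fine n M) (n : ℂ) ν *ᵥ v) ⬝ᵥ w := by
  rw [Matrix.dotProduct_mulVec, Matrix.vecMul_conjTranspose, star_star]

/-- **`Σ_{μ,ν} ‖∇_μ∇_ν x‖² = ‖Δx‖²`** on the torus (two summations by parts, using that all the
`∇_μ`, `∇_ν^*` commute). [cite: Balaban1984PropagatorsI, (1.21) p.21, (1.31) p.23, Prop. 1.1 (1.89) p.33 (kernel lemma for the second-order norms; statement and proof ours)] -/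
theorem sum_nsq_fdiff_fdiff (x : Tor (fine n M) × Fin d → ℂ) :
    ∑ p : Fin d × Fin d, nsq (fdiff (fine n M) (n : ℂ) p.1 *ᵥ (fdiff (fine n M) (n : ℂ) p.2 *ᵥ x))
      = nsq (Lap n M *ᵥ x) := by
  apply Complex.ofReal_injective
  calc ((∑ p : Fin d × Fin d,
          nsq (fdiff (fine n M) (n : ℂ) p.1 *ᵥ (fdiff (fine n M) (n : ℂ) p.2 *ᵥ x)) : ℝ) : ℂ)
      = ∑ ν, ((∑ μ, nsq (fdiff (fine n M) (n : ℂ) μ *ᵥ (fdiff (fine n M) (n : ℂ) ν *ᵥ x)) : ℝ) : ℂ) := by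
          rw [Fintype.sum_prod_type, Finset.sum_comm, Complex.ofReal_sum]
    _ = ∑ ν, star (fdiff (fine n M) (n : ℂ) ν *ᵥ x) ⬝ᵥ (Lap n M *ᵥ (fdiff (fine n M) (n : ℂ) ν *ᵥ x)) :=
          Finset.sum_congr rfl fun ν _ => (form_Lap n M _).symm
    _ = ∑ ν, star x ⬝ᵥ (((fdiff (fine n M) (n : ℂ) ν)ᴴ * fdiff (fine n M) (n : ℂ) ν) *ᵥ (Lap n M *ᵥ x)) := by
          refine Finset.sum_congr rfl fun ν _ => ?_
          rw [← Matrix.mulVec_mulVec, star_dotProduct_fdiffH_mulVec, Matrix.mulVec_mulVec,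
            Lap_mul_fdiff, ← Matrix.mulVec_mulVec]
    _ = star x ⬝ᵥ (Lap n M *ᵥ (Lap n M *ᵥ x)) := by
          rw [Lap_mulVec_sum n M (Lap n M *ᵥ x), dotProduct_sum]
    _ = star (Lap n M *ᵥ x) ⬝ᵥ (Lap n M *ᵥ x) := star_dotProduct_Lap_mulVec n M _ _
    _ = ((nsq (Lap n M *ᵥ x) : ℝ) : ℂ) := star_dotProduct_self _

/-- hence `‖∇_μ∇_ν x‖ ≤ ‖Δx‖` for each pair `(μ, ν)`. [cite: Balaban1984PropagatorsI, Prop. 1.1 (1.89) p.33 (kernel lemma; statement and proof ours)] -/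
theorem l2_fdiff_fdiff_le_l2_Lap (μ ν : Fin d) (x : Tor (fine n M) × Fin d → ℂ) :
    l2 (fdiff (fine n M) (n : ℂ) μ *ᵥ (fdiff (fine n M) (n : ℂ) ν *ᵥ x)) ≤ l2 (Lap n M *ᵥ x) := by
  unfold l2
  refine Real.sqrt_le_sqrt ?_
  rw [← sum_nsq_fdiff_fdiff n M x]
  simp only [Fintype.sum_prod_type]
  set F : Fin d → Fin d → ℝ := fun μ' ν' =>
    nsq (fdiff (fine n M) (n : ℂ) μ' *ᵥ (fdiff (fine n M) (n : ℂ) ν' *ᵥ x)) with hF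
  have h1 : F μ ν ≤ ∑ ν', F μ ν' :=
    Finset.single_le_sum (f := fun ν' => F μ ν') (fun _ _ => nsq_nonneg _) (Finset.mem_univ ν)
  have h2 : ∑ ν', F μ ν' ≤ ∑ μ', ∑ ν', F μ' ν' :=
    Finset.single_le_sum (f := fun μ' => ∑ ν', F μ' ν')
      (fun _ _ => Finset.sum_nonneg fun _ _ => nsq_nonneg _) (Finset.mem_univ μ)
  exact h1.trans h2

/-- `‖−u‖ = ‖u‖`. [folklore] -/
private theorem l2_neg {m : Type*} [Fintype m] (u : m → ℂ) : l2 (-u) = l2 u := by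
  simp [l2, nsq, norm_neg]

include hn ha

/-- for `x = G₀y`: `Δx = y − aQ*Qx`. [cite: Balaban1984PropagatorsI, (1.132) p.39] -/
theorem Lap_mulVec_G0 (y : Tor (fine n M) × Fin d → ℂ) :
    Lap n M *ᵥ (G0 n M a *ᵥ y) = y - (a : ℂ) • ((QvAdj n M * QvOp n M) *ᵥ (G0 n M a *ᵥ y)) := by
  have h := G0inv_mulVec_G0 n hn M a ha y
  rw [G0inv, Matrix.add_mulVec, Matrix.smul_mulVec] at h
  exact eq_sub_of_add_eq h

/-- for `x = G₀y`: `‖Δx‖ ≤ (1 + a‖Q*Q‖γ₀⁻¹)‖y‖`. [cite: Balaban1984PropagatorsI, (1.132) p.39, Prop. 1.1 (1.89) p.33 (kernel lemma; constant and proof ours)] -/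
theorem l2_Lap_G0_le (y : Tor (fine n M) × Fin d → ℂ) :
    l2 (Lap n M *ᵥ (G0 n M a *ᵥ y))
      ≤ (1 + a * ‖QvAdj n M * QvOp n M‖ * (gammaZero d a)⁻¹) * l2 y := by
  rw [Lap_mulVec_G0 n hn M a ha, sub_eq_add_neg]
  refine (l2_add_le _ _).trans ?_
  rw [l2_neg]
  have hv : l2 ((a : ℂ) • ((QvAdj n M * QvOp n M) *ᵥ (G0 n M a *ᵥ y)))
      ≤ a * ‖QvAdj n M * QvOp n M‖ * ((gammaZero d a)⁻¹ * l2 y) := by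
    rw [← Matrix.smul_mulVec]
    refine (l2_mulVec_le _ _).trans ?_
    rw [norm_smul, Complex.norm_real, Real.norm_of_nonneg ha.le]
    exact mul_le_mul_of_nonneg_left (l2_G0_le n hn M a ha y) (mul_nonneg ha.le (norm_nonneg _))
  linarith

/-- (1.89) for `G₀`, fifth bound componentwise: `‖∇_μ∇_ν G₀y‖ ≤ (1 + a‖Q*Q‖γ₀⁻¹)‖y‖`.
[cite: Balaban1984PropagatorsI, Prop. 1.1 (1.89) p.33, p.39 (kernel version; constant and proof
ours)] -/
theorem l2_fdiff_fdiff_G0_le (μ ν : Fin d) (y : Tor (fine n M) × Fin d → ℂ) :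
    l2 (fdiff (fine n M) (n : ℂ) μ *ᵥ (fdiff (fine n M) (n : ℂ) ν *ᵥ (G0 n M a *ᵥ y)))
      ≤ (1 + a * ‖QvAdj n M * QvOp n M‖ * (gammaZero d a)⁻¹) * l2 y :=
  (l2_fdiff_fdiff_le_l2_Lap n M μ ν _).trans (l2_Lap_G0_le n hn M a ha y)

end SecondOrder

/-! ## §4 The Schur bound `‖Q*Q‖ ≤ 1`: rows of `Q_k` are probability vectors, columns sum to `η^d` -/

section Schur

variable {d : ℕ} (n : ℕ) [NeZero n] (M : Fin d → ℕ) [hM : ∀ μ, NeZero (M μ)]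

/-- the (real, nonnegative) entries of `Q_k` (1.18): `q(b; x, μ) = η^{d+1}·#{(j,t) : x = n·b₋ + j + t e_μ}`
for `μ` the direction of `b`, `0` otherwise. [cite: Balaban1984PropagatorsI, (1.18) p.20] -/
def qent (b : Tor M × Fin d) (i : Tor (fine n M) × Fin d) : ℝ :=
  if i.2 = b.2 then ∑ j : Fin d → Fin n, ∑ t : Fin n,
    (if i.1 = bpt n M b.1 j + tstep (fine n M) b.2 t then 1 / (n : ℝ) ^ (d + 1) else 0) else 0

omit [NeZero n] hM in
/-- `q ≥ 0`. [folklore] -/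
private theorem qent_nonneg (b : Tor M × Fin d) (i : Tor (fine n M) × Fin d) : 0 ≤ qent n M b i := by
  unfold qent
  split_ifs
  · exact Finset.sum_nonneg fun _ _ => Finset.sum_nonneg fun _ _ => by positivity
  · exact le_rfl

omit [NeZero n] hM in
/-- the entries of `QvOp` are the real numbers `qent`. [cite: Balaban1984PropagatorsI, (1.18) p.20] -/
theorem QvOp_eq_qent (b : Tor M × Fin d) (i : Tor (fine n M) × Fin d) :
    QvOp n M b i = ((qent n M b i : ℝ) : ℂ) := by
  unfold QvOp qent
  split_ifs with h
  · simp only [Complex.ofReal_sum, apply_ite Complex.ofReal, Complex.ofReal_zero, Complex.ofReal_div,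
      Complex.ofReal_one, Complex.ofReal_pow, Complex.ofReal_natCast]
  · simp

omit [NeZero n] hM in
/-- `|Q_k(b; i)| = q(b; i)`. [folklore] -/
private theorem norm_QvOp (b : Tor M × Fin d) (i : Tor (fine n M) × Fin d) : ‖QvOp n M b i‖ = qent n M b i := by
  rw [QvOp_eq_qent, Complex.norm_real, Real.norm_of_nonneg (qent_nonneg n M b i)]

/-- ROW SUMS of `Q_k`: `Σ_i q(b; i) = 1` (each row averages `n^d·n` bond values with weight `η^{d+1}`).
[cite: Balaban1984PropagatorsI, (1.18) p.20] -/
theorem qent_rowsum (b : Tor M × Fin d) : ∑ i, qent n M b i = 1 := by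
  have hn : (n : ℝ) ≠ 0 := Nat.cast_ne_zero.mpr (NeZero.ne n)
  rw [Fintype.sum_prod_type]
  simp only [qent, Finset.sum_ite_eq', Finset.mem_univ, if_true]
  rw [Finset.sum_comm]
  have h : ∀ j : Fin d → Fin n, ∑ x : Tor (fine n M), ∑ t : Fin n,
      (if x = bpt n M b.1 j + tstep (fine n M) b.2 t then 1 / (n : ℝ) ^ (d + 1) else 0)
      = ∑ _t : Fin n, 1 / (n : ℝ) ^ (d + 1) := by
    intro j
    rw [Finset.sum_comm]
    refine Finset.sum_congr rfl fun t _ => ?_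
    rw [Finset.sum_ite_eq' Finset.univ (bpt n M b.1 j + tstep (fine n M) b.2 t)
      (fun _ => 1 / (n : ℝ) ^ (d + 1))]
    simp
  simp only [h, Finset.sum_const, Finset.card_univ, Fintype.card_fin, Fintype.card_fun,
    nsmul_eq_mul]
  rw [Nat.cast_pow]
  field_simp
  ring

/-- COLUMN SUMS of `Q_k`: `Σ_b q(b; i) = η^d` (every fine bond lies on exactly `n` of the averaging
segments — one for each `t`, by the block decomposition `B5Blocks16.bpt_bijective` — each of weight `η^{d+1}`).
[cite: Balaban1984PropagatorsI, (1.6) p.18, (1.18) p.20] -/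
theorem qent_colsum (i : Tor (fine n M) × Fin d) : ∑ b, qent n M b i = 1 / (n : ℝ) ^ d := by
  have hn : (n : ℝ) ≠ 0 := Nat.cast_ne_zero.mpr (NeZero.ne n)
  rw [Fintype.sum_prod_type]
  simp only [qent]
  have h1 : ∀ y : Tor M, (∑ μ : Fin d, if i.2 = μ then ∑ j : Fin d → Fin n, ∑ t : Fin n,
      (if i.1 = bpt n M y j + tstep (fine n M) μ t then 1 / (n : ℝ) ^ (d + 1) else 0) else 0)
      = ∑ j : Fin d → Fin n, ∑ t : Fin n,
        (if i.1 = bpt n M y j + tstep (fine n M) i.2 t then 1 / (n : ℝ) ^ (d + 1) else 0) := by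
    intro y
    rw [Finset.sum_ite_eq Finset.univ i.2]
    simp
  simp only [h1]
  rw [← Fintype.sum_prod_type', Finset.sum_comm]
  have h2 : ∀ t : Fin n, (∑ p : Tor M × (Fin d → Fin n),
      if i.1 = bpt n M p.1 p.2 + tstep (fine n M) i.2 t then 1 / (n : ℝ) ^ (d + 1) else 0)
      = 1 / (n : ℝ) ^ (d + 1) := by
    intro t
    have e : (∑ p : Tor M × (Fin d → Fin n),
        if i.1 = bpt n M p.1 p.2 + tstep (fine n M) i.2 t then 1 / (n : ℝ) ^ (d + 1) else (0 : ℝ))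
        = ∑ p : Tor M × (Fin d → Fin n),
          (fun x : Tor (fine n M) => if i.1 - tstep (fine n M) i.2 t = x then 1 / (n : ℝ) ^ (d + 1) else 0)
            (bpt n M p.1 p.2) := by
      refine Finset.sum_congr rfl fun p _ => ?_
      simp only [sub_eq_iff_eq_add]
    rw [e, (B5Blocks16.bpt_bijective n M).sum_comp
      (fun x : Tor (fine n M) => if i.1 - tstep (fine n M) i.2 t = x then 1 / (n : ℝ) ^ (d + 1) else 0),
      Finset.sum_ite_eq Finset.univ (i.1 - tstep (fine n M) i.2 t)]
    simp
  simp only [h2, Finset.sum_const, Finset.card_univ, Fintype.card_fin, nsmul_eq_mul]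
  rw [pow_succ]
  field_simp

omit [NeZero n] in
/-- entries of `Q*Q = η^{-d}QᴴQ`: `(Q*Q)(i, j) = n^d Σ_b q(b; i) q(b; j)` (real). [folklore] -/
private theorem QQ_apply (i j : Tor (fine n M) × Fin d) :
    (QvAdj n M * QvOp n M) i j = ((((n : ℝ) ^ d * ∑ b, qent n M b i * qent n M b j : ℝ)) : ℂ) := by
  rw [QvAdj, Matrix.smul_mul, Matrix.smul_apply, Matrix.mul_apply, smul_eq_mul]
  simp only [Matrix.conjTranspose_apply, QvOp_eq_qent, Complex.star_def, Complex.conj_ofReal]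
  push_cast
  rfl

omit [NeZero n] in
/-- `Q*Q` is Hermitian. [cite: Balaban1984PropagatorsI, (1.18) p.20 (kernel lemma; proof ours)] -/
theorem QQ_isHermitian : (QvAdj n M * QvOp n M).IsHermitian := by
  refine Matrix.IsHermitian.ext fun i j => ?_
  rw [QQ_apply, QQ_apply, Complex.star_def, Complex.conj_ofReal,
    show (∑ b, qent n M b j * qent n M b i) = ∑ b, qent n M b i * qent n M b j from
      Finset.sum_congr rfl fun b _ => mul_comm (qent n M b j) (qent n M b i)]

/-- ROW SUMS of `|Q*Q|`: `Σ_j |(Q*Q)(i,j)| = n^d Σ_b q(b;i) Σ_j q(b;j) = n^d · η^d = 1`. [folklore] -/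
private theorem QQ_rowsum (i : Tor (fine n M) × Fin d) : ∑ j, ‖(QvAdj n M * QvOp n M) i j‖ = 1 := by
  have hn : (n : ℝ) ≠ 0 := Nat.cast_ne_zero.mpr (NeZero.ne n)
  have h : ∀ j, ‖(QvAdj n M * QvOp n M) i j‖ = (n : ℝ) ^ d * ∑ b, qent n M b i * qent n M b j := by
    intro j
    rw [QQ_apply, Complex.norm_real, Real.norm_of_nonneg]
    exact mul_nonneg (by positivity)
      (Finset.sum_nonneg fun b _ => mul_nonneg (qent_nonneg n M b i) (qent_nonneg n M b j))
  simp only [h]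
  rw [← Finset.mul_sum, Finset.sum_comm]
  simp only [← Finset.mul_sum, qent_rowsum, mul_one]
  rw [qent_colsum]
  field_simp

/-- **`‖Q*Q‖ ≤ 1`** (Schur test, Hermitian case), uniformly in `η`, `T_η`. [cite: Balaban1984PropagatorsI, (1.18) p.20 (the averaging operator; kernel bound, statement and proof ours)] -/
theorem opNorm_QQ_le : ‖QvAdj n M * QvOp n M‖ ≤ 1 :=
  B5G183RateOp.opNorm_le_of_schur_isHermitian (QQ_isHermitian n M) zero_le_one
    fun i => (QQ_rowsum n M i).le

end Schur

/-! ## §5 One constant `C₀(d,a)` for the six componentwise operator norms of (1.89) for `G₀` -/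

section Constant

variable (d : ℕ) (a : ℝ)

/-- OUR componentwise constant `C₀(d,a) := 1 + (1 + a)·γ₀(d,a)⁻¹` (`γ₀ = gammaZero d a` the
Proposition-1.1 constant for `G`); the paper prints none. [folklore] -/
def CstG0 : ℝ := 1 + (1 + a) * (gammaZero d a)⁻¹

/-- OUR Proposition-1.1 constant for `G₀`: `γ₀(G₀) := 1/((d+1)·C₀(d,a))`, a function of `d` and `a`
only — «independent of k, T_η, and depending on d only (if we put a = 1)». [folklore] -/
def gammaG0 : ℝ := 1 / ((d + 1 : ℝ) * CstG0 d a)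

variable {d a}

/-- `γ₀⁻¹ ≤ C₀` (`a ≥ 0`). [folklore] -/
private theorem gammaZero_inv_le_CstG0 (ha : 0 ≤ a) : (gammaZero d a)⁻¹ ≤ CstG0 d a := by
  have hγ := inv_nonneg.mpr (gammaZero_pos d a).le
  unfold CstG0
  nlinarith

/-- `1 + aγ₀⁻¹ ≤ C₀`. [folklore] -/
private theorem one_add_le_CstG0 : 1 + a * (gammaZero d a)⁻¹ ≤ CstG0 d a := by
  have hγ := inv_nonneg.mpr (gammaZero_pos d a).le
  unfold CstG0
  nlinarith

/-- `1 ≤ C₀` (`a ≥ 0`). [folklore] -/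
private theorem one_le_CstG0 (ha : 0 ≤ a) : 1 ≤ CstG0 d a := by
  have hγ := inv_nonneg.mpr (gammaZero_pos d a).le
  unfold CstG0
  nlinarith

/-- `0 < C₀` (`a ≥ 0`). [folklore] -/
private theorem CstG0_pos (ha : 0 ≤ a) : 0 < CstG0 d a := lt_of_lt_of_le one_pos (one_le_CstG0 ha)

/-- `0 < γ₀(G₀)` (`a ≥ 0`). [folklore] -/
private theorem gammaG0_pos (ha : 0 ≤ a) : 0 < gammaG0 d a := by
  unfold gammaG0
  have := CstG0_pos (d := d) ha
  positivity

/-- `γ₀(G₀)⁻¹ = (d+1)·C₀`. [folklore] -/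
private theorem gammaG0_inv : (gammaG0 d a)⁻¹ = (d + 1 : ℝ) * CstG0 d a := by
  rw [gammaG0, one_div, inv_inv]

/-- `t·C₀ ≤ γ₀(G₀)⁻¹` whenever `t ≤ d + 1` (`a ≥ 0`). [folklore] -/
private theorem mul_CstG0_le (ha : 0 ≤ a) {t : ℝ} (ht : t ≤ (d + 1 : ℝ)) : t * CstG0 d a ≤ (gammaG0 d a)⁻¹ := by
  rw [gammaG0_inv]
  exact mul_le_mul_of_nonneg_right ht (CstG0_pos ha).le

/-- `C₀ ≤ γ₀(G₀)⁻¹`. [folklore] -/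
private theorem CstG0_le_gammaG0_inv (ha : 0 ≤ a) : CstG0 d a ≤ (gammaG0 d a)⁻¹ := by
  have h := mul_CstG0_le (d := d) ha (t := 1) (by linarith [(Nat.cast_nonneg d : (0 : ℝ) ≤ d)])
  rwa [one_mul] at h

/-- `√d·C₀ ≤ γ₀(G₀)⁻¹`. [folklore] -/
private theorem sqrt_mul_CstG0_le (ha : 0 ≤ a) : Real.sqrt d * CstG0 d a ≤ (gammaG0 d a)⁻¹ := by
  refine mul_CstG0_le ha ?_
  have h0 : (0 : ℝ) ≤ d := Nat.cast_nonneg d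
  calc Real.sqrt d ≤ Real.sqrt ((d + 1 : ℝ) ^ 2) := Real.sqrt_le_sqrt (by nlinarith)
    _ = d + 1 := Real.sqrt_sq (by linarith)

/-- `d·C₀ ≤ γ₀(G₀)⁻¹`. [folklore] -/
private theorem nat_mul_CstG0_le (ha : 0 ≤ a) : (d : ℝ) * CstG0 d a ≤ (gammaG0 d a)⁻¹ :=
  mul_CstG0_le ha (by linarith)

/-- `γ₀(G₀) ≤ γ₀` (`a ≥ 0`): the lower bound (1.90) for `G₀` holds a fortiori with `γ₀(G₀)`. [folklore] -/
private theorem gammaG0_le_gammaZero (ha : 0 ≤ a) : gammaG0 d a ≤ gammaZero d a := by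
  have hγ := gammaZero_pos d a
  have h1 : (gammaZero d a)⁻¹ ≤ (gammaG0 d a)⁻¹ :=
    (gammaZero_inv_le_CstG0 ha).trans (CstG0_le_gammaG0_inv ha)
  exact (inv_le_inv₀ hγ (gammaG0_pos ha)).mp h1

end Constant

/-! ## §6 The six operator norms and the printed tensor form of (1.89) for `G₀`; (1.90) for `G₀` -/

section Tensor

variable {d : ℕ} (n : ℕ) [NeZero n] (hn : 1 ≤ n) (M : Fin d → ℕ) [hM : ∀ μ, NeZero (M μ)]
  (a : ℝ) (ha : 0 < a)

include hn ha

/-- `‖G₀‖ ≤ C₀`. [cite: Balaban1984PropagatorsI, Prop. 1.1 (1.89) p.33, p.39 (kernel version; constant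
and proof ours)] -/
theorem opNorm_G0_le_Cst : ‖G0 n M a‖ ≤ CstG0 d a :=
  (opNorm_G0_le n hn M a ha).trans (gammaZero_inv_le_CstG0 ha.le)

/-- `‖∇_ν G₀‖ ≤ C₀`. [cite: Balaban1984PropagatorsI, Prop. 1.1 (1.89) p.33, p.39 (kernel version;
constant and proof ours)] -/
theorem opNorm_fdiff_G0_le_Cst (ν : Fin d) : ‖fdiff (fine n M) (n : ℂ) ν * G0 n M a‖ ≤ CstG0 d a :=
  (opNorm_fdiff_G0_le n hn M a ha ν).trans (gammaZero_inv_le_CstG0 ha.le)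

/-- `‖G₀∇_ν^*‖ ≤ C₀`. [cite: Balaban1984PropagatorsI, Prop. 1.1 (1.89) p.33, p.39 (kernel version;
constant and proof ours)] -/
theorem opNorm_G0_star_fdiff_le_Cst (ν : Fin d) :
    ‖G0 n M a * star (fdiff (fine n M) (n : ℂ) ν)‖ ≤ CstG0 d a :=
  (opNorm_G0_star_fdiff_le n hn M a ha ν).trans (gammaZero_inv_le_CstG0 ha.le)

/-- `‖∇_ν G₀ ∇_{ν′}^*‖ ≤ C₀`. [cite: Balaban1984PropagatorsI, Prop. 1.1 (1.89) p.33, p.39 (kernel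
version; constant and proof ours)] -/
theorem opNorm_fdiff_G0_star_fdiff_le_Cst (ν ν' : Fin d) :
    ‖fdiff (fine n M) (n : ℂ) ν * G0 n M a * star (fdiff (fine n M) (n : ℂ) ν')‖ ≤ CstG0 d a :=
  (opNorm_fdiff_G0_star_fdiff_le n hn M a ha ν ν').trans (gammaZero_inv_le_CstG0 ha.le)

/-- `‖∇_ν∇_{ν′} G₀‖ ≤ C₀` (second order: `Σ‖∇∇x‖² = ‖Δx‖²`, `Δx = y − aQ*Qx`, `‖Q*Q‖ ≤ 1`).
[cite: Balaban1984PropagatorsI, Prop. 1.1 (1.89) p.33, p.39 (kernel version; constant and proof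
ours)] -/
theorem opNorm_fdiff_fdiff_G0_le_Cst (ν ν' : Fin d) :
    ‖fdiff (fine n M) (n : ℂ) ν * fdiff (fine n M) (n : ℂ) ν' * G0 n M a‖ ≤ CstG0 d a := by
  refine opNorm_le_of_l2_bound _ (CstG0_pos ha.le).le fun w => ?_
  rw [← Matrix.mulVec_mulVec, ← Matrix.mulVec_mulVec]
  refine (l2_fdiff_fdiff_G0_le n hn M a ha ν ν' w).trans (mul_le_mul_of_nonneg_right ?_ (l2_nonneg _))
  refine le_trans ?_ one_add_le_CstG0
  have hγ := inv_nonneg.mpr (gammaZero_pos d a).le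
  have h1 : a * ‖QvAdj n M * QvOp n M‖ ≤ a * 1 := mul_le_mul_of_nonneg_left (opNorm_QQ_le n M) ha.le
  have h2 := mul_le_mul_of_nonneg_right h1 hγ
  linarith

/-- `‖G₀∇_ν^*∇_{ν′}^*‖ ≤ C₀` (the adjoint of the previous one). [cite: Balaban1984PropagatorsI,
Prop. 1.1 (1.89) p.33, p.39 (kernel version; constant and proof ours)] -/
theorem opNorm_G0_star_fdiff_star_fdiff_le_Cst (ν ν' : Fin d) :
    ‖G0 n M a * star (fdiff (fine n M) (n : ℂ) ν) * star (fdiff (fine n M) (n : ℂ) ν')‖ ≤ CstG0 d a := by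
  have h : G0 n M a * star (fdiff (fine n M) (n : ℂ) ν) * star (fdiff (fine n M) (n : ℂ) ν')
      = (fdiff (fine n M) (n : ℂ) ν' * fdiff (fine n M) (n : ℂ) ν * G0 n M a)ᴴ := by
    rw [Matrix.conjTranspose_mul, Matrix.conjTranspose_mul, (G0_isHermitian n hn M a ha).eq,
      Matrix.star_eq_conjTranspose, Matrix.star_eq_conjTranspose, Matrix.mul_assoc]
  rw [h, Matrix.l2_opNorm_conjTranspose]
  exact opNorm_fdiff_fdiff_G0_le_Cst n hn M a ha ν' ν

/-- the six componentwise operator-norm bounds of (1.89) for `G₀` with the single constant `C₀(d,a)`.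
[cite: Balaban1984PropagatorsI, Prop. 1.1 (1.89) p.33, p.39 «we have Proposition 1.1 for G₀»
(kernel version; constant and proof ours)] -/
theorem ineq189_G0_opNorm (ν ν' : Fin d) :
    ‖G0 n M a‖ ≤ CstG0 d a ∧
    ‖fdiff (fine n M) (n : ℂ) ν * G0 n M a‖ ≤ CstG0 d a ∧
    ‖G0 n M a * star (fdiff (fine n M) (n : ℂ) ν)‖ ≤ CstG0 d a ∧
    ‖fdiff (fine n M) (n : ℂ) ν * G0 n M a * star (fdiff (fine n M) (n : ℂ) ν')‖ ≤ CstG0 d a ∧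
    ‖fdiff (fine n M) (n : ℂ) ν * fdiff (fine n M) (n : ℂ) ν' * G0 n M a‖ ≤ CstG0 d a ∧
    ‖G0 n M a * star (fdiff (fine n M) (n : ℂ) ν) * star (fdiff (fine n M) (n : ℂ) ν')‖ ≤ CstG0 d a :=
  ⟨opNorm_G0_le_Cst n hn M a ha, opNorm_fdiff_G0_le_Cst n hn M a ha ν,
    opNorm_G0_star_fdiff_le_Cst n hn M a ha ν, opNorm_fdiff_G0_star_fdiff_le_Cst n hn M a ha ν ν',
    opNorm_fdiff_fdiff_G0_le_Cst n hn M a ha ν ν', opNorm_G0_star_fdiff_star_fdiff_le_Cst n hn M a ha ν ν'⟩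

/-- (1.89) for `G₀`: `‖G₀J‖ ≤ γ₀(G₀)⁻¹‖J‖`. [cite: Balaban1984PropagatorsI, Prop. 1.1 (1.89) p.33, p.39
(kernel version; constant and proof ours)] -/
theorem ineq189_G0 (J : Tor (fine n M) × Fin d → ℂ) :
    l2 (G0 n M a *ᵥ J) ≤ (gammaG0 d a)⁻¹ * l2 J :=
  (l2_mulVec_le _ _).trans (mul_le_mul_of_nonneg_right
    ((opNorm_G0_le_Cst n hn M a ha).trans (CstG0_le_gammaG0_inv ha.le)) (l2_nonneg _))

/-- (1.89) for `G₀`: `‖∇G₀J‖ ≤ γ₀(G₀)⁻¹‖J‖`. [cite: Balaban1984PropagatorsI, Prop. 1.1 (1.89) p.33, p.39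
(kernel version; constant and proof ours)] -/
theorem ineq189_gradG0 (J : Tor (fine n M) × Fin d → ℂ) :
    l2T (grad n M (G0 n M a *ᵥ J)) ≤ (gammaG0 d a)⁻¹ * l2 J := by
  have h : grad n M (G0 n M a *ᵥ J) = fun ν => (fdiff (fine n M) (n : ℂ) ν * G0 n M a) *ᵥ J := by
    funext ν
    simp [grad, Matrix.mulVec_mulVec]
  rw [h]
  refine (l2T_mulVec_le (CstG0_pos ha.le).le
    (fun ν => opNorm_fdiff_G0_le_Cst n hn M a ha ν) J).trans ?_
  rw [sqrt_card_fin]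
  exact mul_le_mul_of_nonneg_right (sqrt_mul_CstG0_le ha.le) (l2_nonneg _)

/-- (1.89) for `G₀`: `‖G₀∇*J‖ ≤ γ₀(G₀)⁻¹‖J‖`. [cite: Balaban1984PropagatorsI, Prop. 1.1 (1.89) p.33, p.39
(kernel version; constant and proof ours)] -/
theorem ineq189_G0divT (J : Fin d → (Tor (fine n M) × Fin d → ℂ)) :
    l2 (G0 n M a *ᵥ divT n M J) ≤ (gammaG0 d a)⁻¹ * l2T J := by
  have h : G0 n M a *ᵥ divT n M J = ∑ ν, (G0 n M a * star (fdiff (fine n M) (n : ℂ) ν)) *ᵥ J ν := by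
    simp [divT, Matrix.mulVec_sum, Matrix.mulVec_mulVec]
  rw [h]
  refine (l2_sum_mulVec_le (CstG0_pos ha.le).le
    (fun ν => opNorm_G0_star_fdiff_le_Cst n hn M a ha ν) J).trans ?_
  rw [sqrt_card_fin]
  exact mul_le_mul_of_nonneg_right (sqrt_mul_CstG0_le ha.le) (l2T_nonneg _)

/-- (1.89) for `G₀`: `‖∇G₀∇*J‖ ≤ γ₀(G₀)⁻¹‖J‖`. [cite: Balaban1984PropagatorsI, Prop. 1.1 (1.89) p.33,
p.39 (kernel version; constant and proof ours)] -/
theorem ineq189_gradG0divT (J : Fin d → (Tor (fine n M) × Fin d → ℂ)) :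
    l2T (grad n M (G0 n M a *ᵥ divT n M J)) ≤ (gammaG0 d a)⁻¹ * l2T J := by
  have h : grad n M (G0 n M a *ᵥ divT n M J)
      = fun ν => ∑ ν', (fdiff (fine n M) (n : ℂ) ν * G0 n M a * star (fdiff (fine n M) (n : ℂ) ν')) *ᵥ J ν' := by
    funext ν
    simp [grad, divT, Matrix.mulVec_sum, Matrix.mulVec_mulVec, Matrix.mul_assoc]
  rw [h]
  refine (l2T_sum_mulVec_le (T := Fin d) (S := Fin d)
    (X := fun ν ν' => fdiff (fine n M) (n : ℂ) ν * G0 n M a * star (fdiff (fine n M) (n : ℂ) ν'))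
    (CstG0_pos ha.le).le (fun ν ν' => opNorm_fdiff_G0_star_fdiff_le_Cst n hn M a ha ν ν') J).trans ?_
  rw [sqrt_card_fin, Real.mul_self_sqrt (Nat.cast_nonneg _)]
  exact mul_le_mul_of_nonneg_right (nat_mul_CstG0_le ha.le) (l2T_nonneg _)

/-- (1.89) for `G₀`: `‖∇∇G₀J‖ ≤ γ₀(G₀)⁻¹‖J‖`. [cite: Balaban1984PropagatorsI, Prop. 1.1 (1.89) p.33, p.39
(kernel version; constant and proof ours)] -/
theorem ineq189_grad2G0 (J : Tor (fine n M) × Fin d → ℂ) :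
    l2T (grad2 n M (G0 n M a *ᵥ J)) ≤ (gammaG0 d a)⁻¹ * l2 J := by
  have h : grad2 n M (G0 n M a *ᵥ J)
      = fun p : Fin d × Fin d => (fdiff (fine n M) (n : ℂ) p.1 * fdiff (fine n M) (n : ℂ) p.2 * G0 n M a) *ᵥ J := by
    funext p
    simp [grad2, Matrix.mulVec_mulVec, Matrix.mul_assoc]
  rw [h]
  refine (l2T_mulVec_le (S := Fin d × Fin d)
    (X := fun p => fdiff (fine n M) (n : ℂ) p.1 * fdiff (fine n M) (n : ℂ) p.2 * G0 n M a)
    (CstG0_pos ha.le).le (fun p => opNorm_fdiff_fdiff_G0_le_Cst n hn M a ha p.1 p.2) J).trans ?_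
  rw [sqrt_card_fin_prod]
  exact mul_le_mul_of_nonneg_right (nat_mul_CstG0_le ha.le) (l2_nonneg _)

/-- (1.89) for `G₀`: `‖G₀∇*∇*J‖ ≤ γ₀(G₀)⁻¹‖J‖`. [cite: Balaban1984PropagatorsI, Prop. 1.1 (1.89) p.33,
p.39 (kernel version; constant and proof ours)] -/
theorem ineq189_G0divT2 (J : Fin d × Fin d → (Tor (fine n M) × Fin d → ℂ)) :
    l2 (G0 n M a *ᵥ divT2 n M J) ≤ (gammaG0 d a)⁻¹ * l2T J := by
  have h : G0 n M a *ᵥ divT2 n M J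
      = ∑ p : Fin d × Fin d, (G0 n M a * star (fdiff (fine n M) (n : ℂ) p.1)
          * star (fdiff (fine n M) (n : ℂ) p.2)) *ᵥ J p := by
    simp [divT2, Matrix.mulVec_sum, Matrix.mulVec_mulVec, Matrix.mul_assoc]
  rw [h]
  refine (l2_sum_mulVec_le (S := Fin d × Fin d)
    (X := fun p => G0 n M a * star (fdiff (fine n M) (n : ℂ) p.1) * star (fdiff (fine n M) (n : ℂ) p.2))
    (CstG0_pos ha.le).le (fun p => opNorm_G0_star_fdiff_star_fdiff_le_Cst n hn M a ha p.1 p.2) J).trans ?_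
  rw [sqrt_card_fin_prod]
  exact mul_le_mul_of_nonneg_right (nat_mul_CstG0_le ha.le) (l2T_nonneg _)

open scoped MatrixOrder in
/-- **(1.90) for `G₀` with the constant `γ₀(G₀)`**: `γ₀(G₀)(Δ + I) ≤ Δ + aQ*Q` (Löwner order).
[cite: Balaban1984PropagatorsI, Prop. 1.1 (1.90) p.33, p.39 (kernel version; constant and proof ours)] -/
theorem ineq190_G0 : ((gammaG0 d a : ℝ) : ℂ) • (Lap n M + 1) ≤ G0inv n M a := by
  have h1 := smul_LapOne_le_G0inv n hn M a ha
  have h2 : ((gammaG0 d a : ℝ) : ℂ) • (Lap n M + 1) ≤ ((gammaZero d a : ℝ) : ℂ) • (Lap n M + 1) := by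
    rw [Matrix.le_iff, ← sub_smul, ← Complex.ofReal_sub, ← sum_VbH_Vb, Finset.smul_sum]
    exact Matrix.posSemidef_sum _ fun α _ =>
      smul_gram_posSemidef _ (sub_nonneg.mpr (gammaG0_le_gammaZero ha.le)) _
  exact h2.trans h1

/-- (1.90) for `G₀` as quadratic forms: `γ₀(G₀)⟨A, (Δ + I)A⟩ ≤ ⟨A, (Δ + aQ*Q)A⟩`.
[cite: Balaban1984PropagatorsI, Prop. 1.1 (1.90) p.33, p.39 (kernel version; constant and proof ours)] -/
theorem ineq190_G0_form (A : Tor (fine n M) × Fin d → ℂ) :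
    gammaG0 d a * (star A ⬝ᵥ ((Lap n M + 1) *ᵥ A)).re ≤ (star A ⬝ᵥ (G0inv n M a *ᵥ A)).re := by
  have h := form_key n hn M a ha A
  have hnn : 0 ≤ ∑ α, nsq (Vb n M α *ᵥ A) := Finset.sum_nonneg fun _ _ => nsq_nonneg _
  rw [form_LapOne, Complex.ofReal_re]
  exact (mul_le_mul_of_nonneg_right (gammaG0_le_gammaZero ha.le) hnn).trans h

end Tensor

/-! ## §7 Proposition 1.1 for `G₀` in the printed quantifier order, and `B5.Prop11Printed` BY NAME -/

open scoped MatrixOrder in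
/-- **Proposition 1.1 for `G₀ = (Δ + aQ*Q)⁻¹` (B5 p. 39 «we have Proposition 1.1 for G₀») for the typed
lattice operators**: for every `d` and every `a > 0` there is ONE constant `γ₀(G₀) > 0` — «independent of
k, T_η» — such that for EVERY `n ≥ 1` (`η = 1/n`) and EVERY coarse torus `M`: `G₀` is symmetric, the six
bounds (1.89) hold for `G₀` with `γ₀(G₀)⁻¹` (tensor reading of `B5Prop11Lattice`), and (1.90) holds for
`G₀⁻¹ = Δ + aQ*Q`: `γ₀(G₀)(Δ + I) ≤ Δ + aQ*Q`. [cite: Balaban1984PropagatorsI, Prop. 1.1 (1.89)–(1.90)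
p.33, (1.132)–(1.134) p.39 (kernel version for the typed operators; constant and proof ours)] -/
theorem prop11_G0_lattice {d : ℕ} (a : ℝ) (ha : 0 < a) :
    ∃ γ₀ : ℝ, 0 < γ₀ ∧ ∀ (n : ℕ) [NeZero n], 1 ≤ n → ∀ (M : Fin d → ℕ) [∀ μ, NeZero (M μ)],
      (G0 n M a).IsHermitian ∧
      (∀ J, l2 (G0 n M a *ᵥ J) ≤ γ₀⁻¹ * l2 J) ∧
      (∀ J, l2T (grad n M (G0 n M a *ᵥ J)) ≤ γ₀⁻¹ * l2 J) ∧
      (∀ J, l2 (G0 n M a *ᵥ divT n M J) ≤ γ₀⁻¹ * l2T J) ∧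
      (∀ J, l2T (grad n M (G0 n M a *ᵥ divT n M J)) ≤ γ₀⁻¹ * l2T J) ∧
      (∀ J, l2T (grad2 n M (G0 n M a *ᵥ J)) ≤ γ₀⁻¹ * l2 J) ∧
      (∀ J, l2 (G0 n M a *ᵥ divT2 n M J) ≤ γ₀⁻¹ * l2T J) ∧
      ((γ₀ : ℂ) • (Lap n M + 1) ≤ G0inv n M a) :=
  ⟨gammaG0 d a, gammaG0_pos ha.le, fun n _ hn M _ =>
    ⟨G0_isHermitian n hn M a ha,
     fun J => ineq189_G0 n hn M a ha J,
     fun J => ineq189_gradG0 n hn M a ha J,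
     fun J => ineq189_G0divT n hn M a ha J,
     fun J => ineq189_gradG0divT n hn M a ha J,
     fun J => ineq189_grad2G0 n hn M a ha J,
     fun J => ineq189_G0divT2 n hn M a ha J,
     ineq190_G0 n hn M a ha⟩⟩

section Model

variable {d : ℕ} (n : ℕ) [NeZero n] (M : Fin d → ℕ) [∀ μ, NeZero (M μ)]

/-- The six norms of (1.89) FOR `G₀`, `m = 0, …, 5` ↔ `‖G₀J‖, ‖∇G₀J‖, ‖G₀∇*J‖, ‖∇G₀∇*J‖, ‖∇∇G₀J‖, ‖G₀∇*∇*J‖`,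
on the same argument type `B5Prop11SettingModel.Loc189` as for `G` (same tensor reading).
[cite: Balaban1984PropagatorsI, Prop. 1.1 (1.89) p.33, p.39] -/
def l2opG0 (a : ℝ) (m : Fin 6) : B5Prop11SettingModel.Loc189 n M → ℝ
  | .vec J => (![l2 (G0 n M a *ᵥ J), l2T (grad n M (G0 n M a *ᵥ J)), 0, 0,
      l2T (grad2 n M (G0 n M a *ᵥ J)), 0] : Fin 6 → ℝ) m
  | .ten J => (![0, 0, l2 (G0 n M a *ᵥ divT n M J), l2T (grad n M (G0 n M a *ᵥ divT n M J)), 0, 0] :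
      Fin 6 → ℝ) m
  | .ten2 J => (![0, 0, 0, 0, 0, l2 (G0 n M a *ᵥ divT2 n M J)] : Fin 6 → ℝ) m

variable {n M}

/-- **(1.89) for `G₀` on the model, all six norms and all arguments at once**: `l2opG0 a m J ≤ γ₀(G₀)⁻¹‖J‖`.
[cite: Balaban1984PropagatorsI, Prop. 1.1 (1.89) p.33, p.39 (kernel version; constant and proof ours)] -/
theorem l2opG0_le (a : ℝ) (ha : 0 < a) (m : Fin 6) (J : B5Prop11SettingModel.Loc189 n M) :
    l2opG0 n M a m J ≤ (gammaG0 d a)⁻¹ * B5Prop11SettingModel.locNorm J := by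
  have hn : 1 ≤ n := Nat.one_le_iff_ne_zero.mpr (NeZero.ne n)
  have h0 : ∀ J : B5Prop11SettingModel.Loc189 n M,
      (0 : ℝ) ≤ (gammaG0 d a)⁻¹ * B5Prop11SettingModel.locNorm J := fun J =>
    mul_nonneg (inv_nonneg.mpr (gammaG0_pos ha.le).le) (B5Prop11SettingModel.locNorm_nonneg J)
  cases J with
  | vec J =>
      fin_cases m
      · exact ineq189_G0 n hn M a ha J
      · exact ineq189_gradG0 n hn M a ha J
      · exact h0 (.vec J)
      · exact h0 (.vec J)
      · exact ineq189_grad2G0 n hn M a ha J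
      · exact h0 (.vec J)
  | ten J =>
      fin_cases m
      · exact h0 (.ten J)
      · exact h0 (.ten J)
      · exact ineq189_G0divT n hn M a ha J
      · exact ineq189_gradG0divT n hn M a ha J
      · exact h0 (.ten J)
      · exact h0 (.ten J)
  | ten2 J =>
      fin_cases m
      · exact h0 (.ten2 J)
      · exact h0 (.ten2 J)
      · exact h0 (.ten2 J)
      · exact h0 (.ten2 J)
      · exact h0 (.ten2 J)
      · exact ineq189_G0divT2 n hn M a ha J

end Model

/-- **The lattice model of the carrier `B5.Setting` for `G₀`**: the model `B5Prop11SettingModel.latticeSetting`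
of pass p15 with the Proposition-1.1 fields re-pointed at `G₀ = (Δ + aQ*Q)⁻¹`: `l2op = l2opG0 n M a` (the six
norms of (1.89) for `G₀`) and `formΔa A = Re⟨A, (Δ + aQ*Q)A⟩` (the left side `G₀⁻¹` of (1.90) for `G₀`);
everything else (the Proposition-1.2 fields `o`, `Loc189`, `locNorm`, `formΔI A = Re⟨A, (Δ + I)A⟩`) unchanged.
[cite: Balaban1984PropagatorsI, Prop. 1.1 (1.89)–(1.90) p.33, (1.132)–(1.134) p.39] -/
def latticeSettingG0 {d : ℕ} (k : ℕ) (n : ℕ) [NeZero n] (M : Fin d → ℕ) [∀ μ, NeZero (M μ)] (a : ℝ)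
    (o : B5Prop11SettingModel.Prop12Fields (B5Prop11SettingModel.Loc189 n M)) : B5.Setting :=
  { B5Prop11SettingModel.latticeSetting k n M a o with
    l2op := l2opG0 n M a
    formΔa := fun A => (star A ⬝ᵥ (G0inv n M a *ᵥ A)).re }

section ModelLemmas

variable {d : ℕ} (k : ℕ) (n : ℕ) [NeZero n] (M : Fin d → ℕ) [∀ μ, NeZero (M μ)] (a : ℝ)
  (o : B5Prop11SettingModel.Prop12Fields (B5Prop11SettingModel.Loc189 n M))

/-- unfolding: `l2op` of the `G₀` model is `l2opG0`. [cite: Balaban1984PropagatorsI, Prop. 1.1 (1.89) p.33, p.39] -/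
@[simp] theorem latticeSettingG0_l2op : (latticeSettingG0 k n M a o).l2op = l2opG0 n M a := rfl

/-- unfolding: `l2Norm` of the `G₀` model is `locNorm`. [cite: Balaban1984PropagatorsI, Prop. 1.1 (1.89) p.33] -/
@[simp] theorem latticeSettingG0_l2Norm :
    (latticeSettingG0 k n M a o).l2Norm = B5Prop11SettingModel.locNorm := rfl

/-- unfolding: `formΔa A = Re⟨A, (Δ + aQ*Q)A⟩`. [cite: Balaban1984PropagatorsI, Prop. 1.1 (1.90) p.33, p.39] -/
@[simp] theorem latticeSettingG0_formΔa (A : Tor (fine n M) × Fin d → ℂ) :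
    (latticeSettingG0 k n M a o).formΔa A = (star A ⬝ᵥ (G0inv n M a *ᵥ A)).re := rfl

/-- unfolding: `formΔI A = Re⟨A, (Δ + I)A⟩`. [cite: Balaban1984PropagatorsI, Prop. 1.1 (1.90) p.33] -/
@[simp] theorem latticeSettingG0_formΔI (A : Tor (fine n M) × Fin d → ℂ) :
    (latticeSettingG0 k n M a o).formΔI A = (star A ⬝ᵥ ((Lap n M + 1) *ᵥ A)).re := rfl

end ModelLemmas

/-- **«we have Proposition 1.1 for G₀» (B5 p. 39) — `B5.Prop11Printed` INHABITED BY NAME for the `G₀` lattice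
family**: for any index type `I` and any family `i ↦ (k_i, n_i ≥ 1, M_i, o_i)` of `G₀` lattice settings with one
fixed `a > 0`, ONE `γ₀ > 0` (`= gammaG0 d a`, depending on `d` and `a` only) gives the six bounds (1.89) for `G₀`
and (1.90) for `G₀⁻¹ = Δ + aQ*Q` at every `i`.  This is the input `h11G0` of the composed Proposition-1.2 chain
`B5Prop12Chain.prop12_of_B4_walk`, for the concrete torus operators. [cite: Balaban1984PropagatorsI, Prop. 1.1
(1.89)–(1.90) p.33, (1.132)–(1.134) p.39 (kernel version for the typed operators; constant and proof ours)] -/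
theorem prop11Printed_latticeSettingG0 {d : ℕ} {I : Type} (a : ℝ) (ha : 0 < a) (k : I → ℕ) (n : I → ℕ)
    [∀ i, NeZero (n i)] (M : I → Fin d → ℕ) [∀ i μ, NeZero (M i μ)]
    (o : ∀ i, B5Prop11SettingModel.Prop12Fields (B5Prop11SettingModel.Loc189 (n i) (M i))) :
    B5.Prop11Printed (fun i => latticeSettingG0 (k i) (n i) (M i) a (o i)) := by
  refine ⟨gammaG0 d a, gammaG0_pos ha.le, fun i => ⟨fun m J => ?_, fun A => ?_⟩⟩
  · exact l2opG0_le a ha m J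
  · exact ineq190_G0_form (n i) (Nat.one_le_iff_ne_zero.mpr (NeZero.ne (n i))) (M i) a ha A

/-- The printed indexing `i = (k, T_η)`: `η = L^{-k}` (`n = L^k`, `L ≥ 1`), `T_η` the torus over the coarse torus
with `M_μ ≥ 1` sites per direction. [cite: Balaban1984PropagatorsI, Prop. 1.1 p.33, p.39 (kernel version;
constant and proof ours)] -/
theorem prop11Printed_scalesG0 {d : ℕ} (L : ℕ) [NeZero L] (a : ℝ) (ha : 0 < a)
    (o : ∀ i : ℕ × (Fin d → ℕ+), B5Prop11SettingModel.Prop12Fields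
      (B5Prop11SettingModel.Loc189 (L ^ i.1) (fun μ => ((i.2 μ : ℕ+) : ℕ)))) :
    B5.Prop11Printed
      (fun i : ℕ × (Fin d → ℕ+) => latticeSettingG0 i.1 (L ^ i.1) (fun μ => ((i.2 μ : ℕ+) : ℕ)) a (o i)) :=
  prop11Printed_latticeSettingG0 a ha (fun i : ℕ × (Fin d → ℕ+) => i.1) (fun i : ℕ × (Fin d → ℕ+) => L ^ i.1)
    (fun (i : ℕ × (Fin d → ℕ+)) μ => ((i.2 μ : ℕ+) : ℕ)) o

/-- `a = 1`: «depending on d only (if we put a = 1)». [cite: Balaban1984PropagatorsI, Prop. 1.1 p.33, p.39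
(kernel version; constant and proof ours)] -/
theorem prop11Printed_latticeSettingG0_one {d : ℕ} {I : Type} (k : I → ℕ) (n : I → ℕ) [∀ i, NeZero (n i)]
    (M : I → Fin d → ℕ) [∀ i μ, NeZero (M i μ)]
    (o : ∀ i, B5Prop11SettingModel.Prop12Fields (B5Prop11SettingModel.Loc189 (n i) (M i))) :
    B5.Prop11Printed (fun i => latticeSettingG0 (k i) (n i) (M i) 1 (o i)) :=
  prop11Printed_latticeSettingG0 1 one_pos k n M o

end

end Literature.MathematicalPhysics.QuantumFieldTheory.Balaban1983to89.B5Prop11G0Torus
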